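import Literature.Claims.NS.Zhong2026
import Summits.NavierStokesRegularity.NavierStokesRegularity.Theorems.SoloRefutePermana2026Step7
import HarnessLib

/-!
# C161 `Zhong2026` — records-grade kernel object: the POINTWISE face of (17), `Step_17_loc`, is FALSE

Cell `ns-claims`, row C161 (ADJUDICATED #144: first failing step `Literature.Claims.NS.Zhong2026.Step_exhaustive`,
class false lemma — untouched here). Display (17) p.5 l.72–82 («Dψ/Dt = S₀ + νΔe^ψ/e^ψ − ν|∇ψ|² − ν|∇ω̂|²»)
carries a spurious `−ν|∇ψ|²` (kernel: `…Theorems.Zhong2026Salvage.matDpsi_eq` p537261 / in-file rev 8). The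
skeleton's POINTWISE face `Step_17_loc` (rev 3, l.723: (17) at every interior time and every point with
`ω(t,x) ≠ 0`, no global non-vanishing) is EQUIVALENT, by the in-file `step_17_loc_iff_irrotational` (lit-3 g9,
rev 8 p545897), to «every class solution has irrotational interior slices». This file supplies the witness
that decides it: the C137 datum `U` (two compactly supported vortex blobs, `curl U ≢ 0` —
`…Theorems.Permana2026.exists_curl_U_ne_zero`) launches a class solution on some `[0,T)` for `ν = 1`
(local existence in the Chae/BKM class, `…Theorems.LucardoOlivaes2026.exists_isLocalSolution`, Majda–Bertozzi
Thm 3.4), and by continuity of `t ↦ curl u(t,x₀)` at `t = 0⁺` (joint smoothness of the classical solution) the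
vorticity at `x₀` stays non-zero at some interior time — so NOT every interior slice is irrotational, and
`Step_17_loc` fails: `not_Step_17_loc`. The verbatim face `Step_17` (global «ω ≠ 0 everywhere» frame) is a
different, weaker assertion and stays «V-or-FL» (`step_17_iff_frame_empty`). Salvage seat
`ns-claims-salvage-p1` g4 (own build; lineage of the C161 salvage).

WHAT THIS IS NOT: not a claim about NS regularity or blow-up; not a claim about any author beyond the typed
locator.
-/

set_option linter.dupNamespace false

noncomputable section

open Set Filter MeasureTheory Topology
open scoped ContDiff

namespace Summit.NavierStokesRegularity.NavierStokesRegularity.Theorems.Zhong2026Salvage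

open Literature.Analysis.FluidPDE Literature.Claims.NS.Zhong2026
open Literature.Claims.NS.Chae2007 (IsLocalSolution)
open Summit.NavierStokesRegularity.NavierStokesRegularity.Theorems.LucardoOlivaes2026GI (U isOuroDatum_U)
open Summit.NavierStokesRegularity.NavierStokesRegularity.Theorems.LucardoOlivaes2026 (exists_isLocalSolution)
open Summit.NavierStokesRegularity.NavierStokesRegularity.Theorems.Permana2026 (exists_curl_U_ne_zero)

/-- **Continuity of the vorticity at a fixed point, at the initial time**: along a class solution on `[0,T)`,
`t ↦ curl u(t,x₀)` is continuous within `[0,T)` at `t = 0` (joint smoothness of `D u`). [folklore] -/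
theorem continuousWithinAt_curl_zero {ν T : ℝ} {v₀ : E3 → E3} {u : ℝ → E3 → E3} {p : ℝ → E3 → ℝ}
    (hsol : IsLocalSolution ν T v₀ u p) (hT : 0 < T) (x₀ : E3) :
    ContinuousWithinAt (fun t => curl (u t) x₀) (Ico 0 T) 0 := by
  have h0S : (0 : ℝ) ∈ Ico 0 T := ⟨le_rfl, hT⟩
  have hD : ContinuousOn (fun z : ℝ × E3 => fderiv ℝ (u z.1) z.2) (Ico 0 T ×ˢ univ) :=
    hsol.isClassical.smooth_velocity.continuousOn_fderiv_slice (uniqueDiffOn_Ico 0 T)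
  have hpath : ContinuousWithinAt (fun t : ℝ => ((t, x₀) : ℝ × E3)) (Ico 0 T) 0 :=
    (continuous_id.prodMk continuous_const).continuousWithinAt
  have hmaps : MapsTo (fun t : ℝ => ((t, x₀) : ℝ × E3)) (Ico 0 T) (Ico 0 T ×ˢ univ) :=
    fun t ht => ⟨ht, mem_univ _⟩
  have hF : ContinuousWithinAt (fun t => fderiv ℝ (u t) x₀) (Ico 0 T) 0 :=
    ContinuousWithinAt.comp (f := fun t : ℝ => ((t, x₀) : ℝ × E3)) (x := (0 : ℝ))
      (hD (0, x₀) ⟨h0S, mem_univ _⟩) hpath hmaps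
  have hfun : (fun t => curl (u t) x₀) = fun t => curlCLM (fderiv ℝ (u t) x₀) :=
    funext fun t => curl_eq_curlCLM _ _
  rw [hfun]
  exact curlCLM.continuous.continuousAt.comp_continuousWithinAt hF

/-- **A class solution with a non-irrotational interior slice exists** (`ν = 1`): the C137 datum `U` has
`curl U x₀ ≠ 0` somewhere; its Chae-class local solution keeps `curl u(t,x₀) ≠ 0` for small `t > 0`.
[cite: MajdaBertozziCUP2002, Thm. 3.4 (local existence)] -/
theorem exists_isLocalSolution_curl_ne_zero :
    ∃ (T : ℝ) (v₀ : E3 → E3) (u : ℝ → E3 → E3) (p : ℝ → E3 → ℝ),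
      IsLocalSolution 1 T v₀ u p ∧ ∃ t ∈ Ioo 0 T, ∃ x : E3, curl (u t) x ≠ 0 := by
  obtain ⟨T, hT, u, p, hsol⟩ := exists_isLocalSolution (ν := 1) zero_le_one isOuroDatum_U.1
  obtain ⟨x₀, hx₀⟩ := exists_curl_U_ne_zero
  refine ⟨T, U, u, p, hsol, ?_⟩
  have hc := continuousWithinAt_curl_zero hsol hT x₀
  have h0 : curl (u 0) x₀ ≠ 0 := by rw [hsol.initial]; exact hx₀
  -- `curl u(t,x₀) ≠ 0` for `t` near `0⁺` within `[0,T)`, hence at some `t ∈ (0,T)`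
  have hev : ∀ᶠ t in 𝓝[Ico 0 T] 0, curl (u t) x₀ ≠ 0 :=
    hc.tendsto.eventually (isOpen_ne.eventually_mem h0)
  have hev' : ∀ᶠ t in 𝓝[Ioo 0 T] 0, curl (u t) x₀ ≠ 0 ∧ t ∈ Ioo 0 T :=
    (hev.filter_mono (nhdsWithin_mono 0 Ioo_subset_Ico_self)).and self_mem_nhdsWithin
  haveI : (𝓝[Ioo 0 T] (0 : ℝ)).NeBot := left_nhdsWithin_Ioo_neBot hT
  obtain ⟨t, htne, ht⟩ := hev'.exists
  exact ⟨t, ht, x₀, htne⟩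

/-- **`Step_17_loc` is false**: by the in-file `step_17_loc_iff_irrotational` it would force every interior
slice of every class solution to be irrotational, against `exists_isLocalSolution_curl_ne_zero`.
[cite: Zhong2026, (17) p.5 l.72–82] -/
theorem not_Step_17_loc : ¬ Step_17_loc := by
  intro h
  obtain ⟨T, v₀, u, p, hsol, t, ht, x, hx⟩ := exists_isLocalSolution_curl_ne_zero
  exact hx (step_17_loc_iff_irrotational.1 h 1 one_pos T v₀ u p hsol t ht x)

/-- FQN guard: the refuted statement is literally the skeleton's decl. [folklore] -/
example : ¬ Literature.Claims.NS.Zhong2026.Step_17_loc := not_Step_17_loc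

end Summit.NavierStokesRegularity.NavierStokesRegularity.Theorems.Zhong2026Salvage

end
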